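import Summits.BirchSwinnertonDyer.Rank1Residual.Supersingular.KobayashiMainConjecture
import Summits.BirchSwinnertonDyer.Rank1Residual.Supersingular.BlindInterpolationFlatTwoUnit
import Summits.BirchSwinnertonDyer.Rank1Residual.Supersingular.SprungPollackConsistency
import Summits.BirchSwinnertonDyer.Rank1Residual.P2.EmptyCellsAtTwo
import Literature.NumberTheory.EllipticCurves.ComplexMultiplication
import Literature.NumberTheory.EllipticCurves.IwasawaAlgebraMuVanishingProofs
import HarnessLib

/-!
# Route `ThetaPartnerAtTwo`, crux K2 `SignedMainConjectureCMTwo` (item stmt-BirchSwinnertonDyer-20307):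
# the UNIT ZONE — where the crux follows, datum by datum, from BSD₂ and control at `2` alone

HONEST FRAMING (cell `pub/bsd-wall`, W-ALL row 1, prover seat `bsd-wall-tp2-p2`): the crux
`Summit.BirchSwinnertonDyer.BirchSwinnertonDyer.Theses.ThetaPartnerAtTwo.SignedMainConjectureCMTwo`
(Pollack–Rubin 2004 Thm. 7.3 ported to `p = 2` + `μ⁺ = 0`, for CM `A/ℚ` good supersingular at `2`)
is NOT in print at `2` and is NOT proved here. This file isolates the part of it that needs no
Iwasawa theory of elliptic units at all. Call `E` (globally minimal, good supersingular at `2`,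
`L(E,1) ≠ 0`) a **unit-zone** curve when `t = L(E,1)/Ω_E` is a `2`-adic unit — by BSD₂(E), which is
IN PRINT for CM `E` (Burungale–Flach 2024, tree fact `bsdTriple_of_hasCM_of_L_one_ne_zero`) and is
otherwise the binder `BSDp E 2`, this says `Ш(E)[2] = 0` and `∏ c_ℓ` odd (`E(ℚ)[2] = 0` being
automatic, `P2.irr_two_of_goodSS_two`). Then, granted GZK (PUB) and B. D. Kim's control term at `2`
(research binder, verbatim the `p = 2` body of the tree door and of crux K4c `SignedControlAtTwo`):

* §1 `charIdeal_eq_top_and_mu_eq_zero_of_unitZone_two` — every finitely generated `Λ`-torsion dual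
  datum `D` of `Sel⁺(E/ℚ_∞)` has `char X⁺ = Λ` and `μ⁺ = 0` (hence `X⁺` pseudo-null): the
  characteristic ideal is principal (`charIdeal_isPrincipal_holds`), a generator `g` has
  `ord₂ g(0) = ord₂ t = 0` (`valuation_constantCoeff_generator_eq_of_bsdp_two`), so `g` is a unit of
  `Λ = ℤ₂⟦T⟧` (`PowerSeries.isUnit_iff_constantCoeff`), and `μ = 0` by the tree theorem
  `muInvariant_eq_zero_iff_exists_isUnit_coeff_of_charIdeal_eq_span` (structure theory of `Λ`-modules,
  proved in the tree).
* §2 `kobayashiMainConjecture_two_one_conclusion_of_unitZone` — if moreover `a₂ = 0` and the period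
  ratio `ϖ` (`ϖ·Ω_E = Ω⁺_f`) is a `2`-adic unit, the CONCLUSION of `KobayashiMainConjecture E 2 1` holds
  at every cyclotomic datum, every Pollack pair `(L⁺, L⁻)` at `2` and every such `D`:
  `char X⁺ = (g)` with `ι g = ϖ·ι L⁻`, `g = ϖ·L⁻ ∈ Λˣ` (`L⁻(0) = L♭(0) = [0]⁺_f = t/ϖ`, a unit).
* §3 `signedMainConjectureCMTwo_pointwise_of_unitZone` — for a CM `A` in the unit zone with `ϖ` a
  unit: Kobayashi Thm. 1.2 at `2` for `A` (f.g. + torsion) and Kim Cor. 3.15 at `2` for `A` — the two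
  conjuncts of crux K4c read for `A` — give BOTH conjuncts of crux K2 AT `A` (torsion ∧ `μ⁺ = 0`, and
  `KobayashiMainConjecture A 2 1`), the rest being PUB (Burungale–Flach, GZK, modularity by name).
  Outside the unit zone (`Ш(A)[2] ≠ 0` or `∏ c_ℓ` even or `ϖ` not a unit — e.g. the anchors 121b1,
  361a1 with `λ♭ ≥ 1` in the route's census) the crux constrains the NON-constant coefficients of a
  generator of `char X⁺` and nothing here applies.

Route-independent (no `Theses` module is imported): the `T = 0` valuation identity of the sibling
file `ThetaPartnerAtTwoSignedMainConjectureCMTwo.lean` (`valuation_constantCoeff_generator_eq_of_bsdp_two`,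
which sits in the route's cone) is re-derived here as a private lemma.

References: [PollackRubin2004] Thm. 7.3 (p > 2); [Kobayashi2003] Thm. 1.2, Conjecture p. 2;
[BDKim2013] Cor. 3.15; [BurungaleFlach2024] Thm. 1.1; [Washington1997] §13.2; [GreenbergVatsal2000]
p. 2 (μ = 0 ⟺ p ∤ char. power series); [Sprung2017] Thm. 1.12, Cor. 4.4; [Miller2011LMS] Def. 1.1.
-/

set_option autoImplicit false
-- the Theorems namespace of this sub repeats the summit name by design (D-0017 nested layout)
set_option linter.dupNamespace false

noncomputable section

open scoped Classical MatrixGroups ModularForm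

open CongruenceSubgroup WeierstrassCurve Literature.NumberTheory.EllipticCurves
  Literature.NumberTheory.EllipticCurves.ModularForms Literature.NumberTheory.EllipticCurves.Sprung2017
  Literature.NumberTheory.EllipticCurves.Rank1Residual Literature.NumberTheory.EllipticCurves.Rank1Residual.Typed
  Literature.NumberTheory.EllipticCurves.Kobayashi2003 ZpExtension
  Summit.BirchSwinnertonDyer.Rank1Residual Summit.BirchSwinnertonDyer.Rank1Residual.Supersingular

namespace Summit.BirchSwinnertonDyer.BirchSwinnertonDyer.Theorems

variable (A : WeierstrassCurve ℚ) [A.IsElliptic] [A.IsGloballyMinimal]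

/-! ## §0. The `T = 0` valuation identity (route-independent copy) -/

section TrivialCharacter

/-- **`ord₂ g(0) = ord₂ L(E,1)/Ω_E` from BSD₂ + GZK + Kim's control term at `2`** (good supersingular
at `2`, `L(E,1) ≠ 0`, `D` a f.g. torsion dual datum of `Sel⁺(E/ℚ_∞)`, `g` a generator of `char X⁺`).
The same statement and proof as `valuation_constantCoeff_generator_eq_of_bsdp_two` of the sibling file
`ThetaPartnerAtTwoSignedMainConjectureCMTwo.lean`, repeated privately so that this file imports no
route module: Kim + GZK give `ord₂ g(0) = ord₂ ∏c_ℓ + ord₂ #Ш` (`valuation_constantCoeff_xi`); BSD₂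
gives `ord₂ #Ш_an = ord₂ #Ш` (`missingPPartAt_of_bsdp`) with `#Ш_an = t·#tors²/∏c_ℓ`
(`shaAn_eq_of_analyticRank_eq_zero`, `2 ∤ #tors` by `P2.irr_two_of_goodSS_two`).
[cite: BDKim2013, Cor. 3.15 (p. 199; p odd in print)] [cite: Miller2011LMS, Def. 1.1] -/
private theorem valuation_constantCoeff_generator_eq_of_bsdp_two_aux
    (hGZK : rank_eq_analyticRank_of_analyticRank_le_one)
    (hss : GoodSS A 2) (hL : A.entireLFunction 1 ≠ 0) (hBSD : BSDp A 2)
    (hKim : ∀ (κ : ZpExtension ℚ 2) (γ : Field.absoluteGaloisGroup ℚ),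
      κ.IsCyclotomic → κ.IsTopGenerator γ →
      ∀ (D : SignedSelmerDualData A κ γ 1) [Module.Finite (IwasawaAlgebra 2) D.X],
        Module.IsTorsion (IwasawaAlgebra 2) D.X →
      ∀ g : IwasawaAlgebra 2, D.charIdeal = Ideal.span {g} → Finite (A.selmerGroupPInfty 2) →
        ∃ u : ℤ_[2]ˣ, ((PowerSeries.constantCoeff g : ℤ_[2]) : ℚ_[2]) =
          ((u : ℤ_[2]) : ℚ_[2]) * ((2 : ℕ) : ℚ_[2]) ^ (padicValNat 2 A.tamagawaProduct) *
            (Nat.card (A.selmerGroupPInfty 2) : ℚ_[2]))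
    {κ : ZpExtension ℚ 2} {γ : Field.absoluteGaloisGroup ℚ} (hκ : κ.IsCyclotomic)
    (hγ : κ.IsTopGenerator γ) (D : SignedSelmerDualData A κ γ 1)
    [Module.Finite (IwasawaAlgebra 2) D.X] (hTors : Module.IsTorsion (IwasawaAlgebra 2) D.X)
    {g : IwasawaAlgebra 2} (hchar : D.charIdeal = Ideal.span {g})
    {t : ℚ} (ht : A.entireLFunction 1 / (A.realPeriodRat : ℂ) = (t : ℂ)) :
    ((PowerSeries.constantCoeff g : ℤ_[2]) : ℚ_[2]) ≠ 0 ∧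
      (((PowerSeries.constantCoeff g : ℤ_[2]) : ℚ_[2])).valuation = padicValRat 2 t := by
  have hr : A.analyticRank = 0 := analyticRank_eq_zero_of_entireLFunction_one_ne_zero A hL
  have hirr : A.HasIrreducibleModPGaloisRep 2 := P2.irr_two_of_goodSS_two A hss
  have hΩ : (A.realPeriodRat : ℂ) ≠ 0 := Complex.ofReal_ne_zero.mpr A.realPeriodRat_pos_holds.ne'
  have ht0 : t ≠ 0 := by
    rintro rfl
    apply hL
    have h := ht
    rw [div_eq_iff hΩ] at h
    rw [h]
    simp
  have hK : (⟨g, 0, 0⟩ : SignedDatum A 2).EulerCharacteristic := fun hfin ↦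
    hKim κ γ hκ hγ D hTors g hchar hfin
  obtain ⟨hne, hvg⟩ := valuation_constantCoeff_xi A 2 hGZK hL ⟨g, 0, 0⟩ hK
  haveI : Finite A.sha := (hGZK A (by omega)).2
  obtain ⟨q, hq, hv⟩ := missingPPartAt_of_bsdp A 2 hBSD
  have hsha := shaAn_eq_of_analyticRank_eq_zero A hGZK hr ht
  have hqt : q = t * (A.torsionOrder : ℚ) ^ 2 / (A.tamagawaProduct : ℚ) := by
    have h := hq.symm.trans hsha
    exact_mod_cast h
  rw [hqt, padicValRat_shaAn_witness A 2 hirr ht0] at hv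
  refine ⟨hne, ?_⟩
  rw [hvg]
  linarith

end TrivialCharacter

/-! ## §1. `char X⁺ = Λ` and `μ⁺ = 0` in the unit zone -/

section UnitZone

/-- **Unit zone ⇒ `char X⁺(E/ℚ_∞) = Λ` and `μ⁺ = 0`.** Let `E = W` be globally minimal, good
supersingular at `2`, with `L(E,1)/Ω_E = t` a `2`-ADIC UNIT (`ord₂ t = 0`; under BSD₂: `Ш(E)[2] = 0`
and `∏ c_ℓ` odd). Grant GZK (`hGZK`, PUB), `BSD(E,2)` (`hBSD`) and Kim's control term at `2` (`hKim`,
research binder). Then every finitely generated `Λ`-torsion dual datum `D` of `Sel⁺(E/ℚ_∞)` has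
`D.charIdeal = ⊤` and `D.mu = 0`. Proof: `char X⁺` is principal (`charIdeal_isPrincipal_holds`, `Λ` a
UFD), a generator `g` has `ord₂ g(0) = ord₂ t = 0` (`valuation_constantCoeff_generator_eq_of_bsdp_two`),
so `g(0) ∈ ℤ₂ˣ`, `g ∈ Λˣ` (`PowerSeries.isUnit_iff_constantCoeff`), `(g) = Λ`; and `μ = 0` iff some
coefficient of a generator is a unit (`muInvariant_eq_zero_iff_exists_isUnit_coeff_of_charIdeal_eq_span`).
Nothing asserted beyond the binders. [cite: Washington1997, §13.2] [cite: GreenbergVatsal2000, p. 2, (1)–(2)]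
[cite: BDKim2013, Cor. 3.15 (p odd in print)] -/
theorem charIdeal_eq_top_and_mu_eq_zero_of_unitZone_two
    (hGZK : rank_eq_analyticRank_of_analyticRank_le_one)
    (hss : GoodSS A 2) (hL : A.entireLFunction 1 ≠ 0) (hBSD : BSDp A 2)
    (hKim : ∀ (κ : ZpExtension ℚ 2) (γ : Field.absoluteGaloisGroup ℚ),
      κ.IsCyclotomic → κ.IsTopGenerator γ →
      ∀ (D : SignedSelmerDualData A κ γ 1) [Module.Finite (IwasawaAlgebra 2) D.X],
        Module.IsTorsion (IwasawaAlgebra 2) D.X →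
      ∀ g : IwasawaAlgebra 2, D.charIdeal = Ideal.span {g} → Finite (A.selmerGroupPInfty 2) →
        ∃ u : ℤ_[2]ˣ, ((PowerSeries.constantCoeff g : ℤ_[2]) : ℚ_[2]) =
          ((u : ℤ_[2]) : ℚ_[2]) * ((2 : ℕ) : ℚ_[2]) ^ (padicValNat 2 A.tamagawaProduct) *
            (Nat.card (A.selmerGroupPInfty 2) : ℚ_[2]))
    {κ : ZpExtension ℚ 2} {γ : Field.absoluteGaloisGroup ℚ} (hκ : κ.IsCyclotomic)
    (hγ : κ.IsTopGenerator γ) (D : SignedSelmerDualData A κ γ 1)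
    [Module.Finite (IwasawaAlgebra 2) D.X] (hTors : Module.IsTorsion (IwasawaAlgebra 2) D.X)
    {t : ℚ} (ht : A.entireLFunction 1 / (A.realPeriodRat : ℂ) = (t : ℂ)) (ht1 : padicValRat 2 t = 0) :
    D.charIdeal = ⊤ ∧ D.mu = 0 := by
  -- a generator of the (principal) characteristic ideal
  obtain ⟨g, hg⟩ := (charIdeal_isPrincipal_holds 2 D.X).principal
  have hchar : D.charIdeal = Ideal.span {g} := hg
  -- its constant term is a `2`-adic unit
  obtain ⟨hne, hval⟩ := valuation_constantCoeff_generator_eq_of_bsdp_two_aux A hGZK hss hL hBSD hKim hκ hγ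
    D hTors hchar ht
  rw [ht1] at hval
  have hnorm : ‖(PowerSeries.constantCoeff g : ℤ_[2])‖ = 1 := by
    rw [PadicInt.norm_def, Padic.norm_eq_zpow_neg_valuation hne, hval]
    simp
  have hunit0 : IsUnit (PowerSeries.constantCoeff g : ℤ_[2]) := PadicInt.isUnit_iff.mpr hnorm
  have hunit : IsUnit g := PowerSeries.isUnit_iff_constantCoeff.mpr hunit0
  refine ⟨?_, ?_⟩
  · rw [hchar, Ideal.span_singleton_eq_top]
    exact hunit
  · change muInvariant 2 D.X = 0
    rw [muInvariant_eq_zero_iff_exists_isUnit_coeff_of_charIdeal_eq_span D.X hTors hg]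
    exact ⟨0, by rwa [PowerSeries.coeff_zero_eq_constantCoeff]⟩

end UnitZone

/-! ## §2. The conclusion of `KobayashiMainConjecture E 2 1` in the unit zone -/

section MainConjecture

/-- **Unit zone (with `ϖ` a unit) ⇒ the conclusion of Kobayashi's `+` main conjecture at `2`.**
In the setting of `charIdeal_eq_top_and_mu_eq_zero_of_unitZone_two` assume moreover `a₂ = 0`, let
`f` be the newform of `E` with period ratio `ϖ` (`ϖ·Ω_E = Ω⁺_f`) a `2`-ADIC UNIT, and let
`(L⁺, L⁻)` be any Pollack pair at `2` (a Sprung pair at `a₂ = 0`, `isSprungPair_zero_iff`, so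
`L⁻(0) = [0]⁺_f`, `constantCoeff_flat_two_of_isSprungPair_of_isNewformOf`). Then for every f.g.
torsion dual datum `D` of `Sel⁺(E/ℚ_∞)`: `char X⁺ = (g)` with `ι g = ϖ·ι L⁻` — VERBATIM the
conclusion of `KobayashiMainConjecture E 2 1` at this datum — with `g = ϖ·L⁻ ∈ Λˣ`
(`ϖ·[0]⁺_f = t` is a unit, so `[0]⁺_f`, `L⁻(0)` and `g(0)` are units) and `char X⁺ = Λ` (§1).
Nothing asserted beyond the binders. [cite: Kobayashi2003, Conjecture (p. 2) and (3.6)]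
[cite: Sprung2017, Thm. 1.12, Cor. 4.4] [cite: BDKim2013, Cor. 3.15 (p odd in print)] -/
theorem kobayashiMainConjecture_two_one_conclusion_of_unitZone
    (hGZK : rank_eq_analyticRank_of_analyticRank_le_one)
    (hss : GoodSS A 2) (ha : A.frobeniusTrace 2 = 0) (hL : A.entireLFunction 1 ≠ 0)
    (hBSD : BSDp A 2)
    (hKim : ∀ (κ : ZpExtension ℚ 2) (γ : Field.absoluteGaloisGroup ℚ),
      κ.IsCyclotomic → κ.IsTopGenerator γ →
      ∀ (D : SignedSelmerDualData A κ γ 1) [Module.Finite (IwasawaAlgebra 2) D.X],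
        Module.IsTorsion (IwasawaAlgebra 2) D.X →
      ∀ g : IwasawaAlgebra 2, D.charIdeal = Ideal.span {g} → Finite (A.selmerGroupPInfty 2) →
        ∃ u : ℤ_[2]ˣ, ((PowerSeries.constantCoeff g : ℤ_[2]) : ℚ_[2]) =
          ((u : ℤ_[2]) : ℚ_[2]) * ((2 : ℕ) : ℚ_[2]) ^ (padicValNat 2 A.tamagawaProduct) *
            (Nat.card (A.selmerGroupPInfty 2) : ℚ_[2]))
    {κ : ZpExtension ℚ 2} {γ : Field.absoluteGaloisGroup ℚ} (hκ : κ.IsCyclotomic)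
    (hγ : κ.IsTopGenerator γ) (D : SignedSelmerDualData A κ γ 1)
    [Module.Finite (IwasawaAlgebra 2) D.X] (hTors : Module.IsTorsion (IwasawaAlgebra 2) D.X)
    [NeZero (A.conductorNorm ℤ)] {f : CuspForm (Gamma0 (A.conductorNorm ℤ)) 2} (hf : IsNewformOf A f)
    {ϖ : ℚ} (hϖ : (ϖ : ℝ) * A.realPeriodRat = plusPeriod f) (hϖ1 : padicValRat 2 ϖ = 0)
    (ht1 : padicValRat 2 (ϖ * ratPlusSymbol f 0) = 0)
    {Lplus Lminus : IwasawaAlgebra 2} (hPP : IsPollackPair f 2 Lplus Lminus) :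
    ∃ g : IwasawaAlgebra 2, D.charIdeal = Ideal.span {g} ∧
      iwasawaToPowerSeries 2 g =
        PowerSeries.C (ϖ : ℚ_[2]) * iwasawaToPowerSeries 2 (kobayashiL 1 Lplus Lminus) := by
  have hΩpos : 0 < A.realPeriodRat := A.realPeriodRat_pos_holds
  have hkL : kobayashiL (1 : ℤˣ) Lplus Lminus = Lminus := by unfold kobayashiL; rw [if_pos rfl]
  rw [hkL]
  -- `t = ϖ · [0]⁺_f = L(E,1)/Ω_E`, a `2`-adic unit
  set s : ℚ := ratPlusSymbol f 0 with hs_def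
  set t : ℚ := ϖ * s with ht_def
  have hLval : A.entireLFunction 1 = (((s : ℝ) * plusPeriod f : ℝ) : ℂ) := hf.entireLFunction_one_eq
  have ht : A.entireLFunction 1 / (A.realPeriodRat : ℂ) = ((t : ℚ) : ℂ) := by
    rw [hLval, ← hϖ, div_eq_iff (Complex.ofReal_ne_zero.mpr hΩpos.ne'), ht_def]
    push_cast
    ring
  have hs0 : s ≠ 0 := by
    intro h0
    apply hL
    rw [hLval, h0]
    simp
  have hϖ0 : ϖ ≠ 0 := by
    rintro rfl
    apply hL
    have h : plusPeriod f = 0 := by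
      have h := hϖ
      simp only [Rat.cast_zero, zero_mul] at h
      exact h.symm
    rw [hLval, h]
    simp
  -- §1: `char X⁺ = Λ`
  obtain ⟨htop, -⟩ := charIdeal_eq_top_and_mu_eq_zero_of_unitZone_two A hGZK hss hL hBSD hKim hκ hγ
    D hTors ht ht1
  -- `ϖ` as a `2`-adic unit `u`
  have hϖQ0 : ((ϖ : ℚ) : ℚ_[2]) ≠ 0 := by exact_mod_cast hϖ0
  have hϖnorm : ‖((ϖ : ℚ) : ℚ_[2])‖ = 1 := by
    rw [Padic.norm_eq_zpow_neg_valuation hϖQ0, Padic.valuation_ratCast, hϖ1]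
    simp
  set u : ℤ_[2] := ⟨((ϖ : ℚ) : ℚ_[2]), hϖnorm.le⟩ with hu_def
  have hu1 : IsUnit u := PadicInt.isUnit_iff.mpr (by rw [PadicInt.norm_def]; exact hϖnorm)
  -- `L⁻(0) = [0]⁺_f`, a `2`-adic unit
  have hSP : IsSprungPair f 2 (A.frobeniusTrace 2) Lplus Lminus := by
    rw [ha]
    exact (isSprungPair_zero_iff f 2 Lplus Lminus).mpr ⟨hPP.2.2.1, hPP.2.2.2⟩
  have hLf0 := constantCoeff_flat_two_of_isSprungPair_of_isNewformOf hf hss.1 hSP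
  rw [ha] at hLf0
  have hLf0' : ((PowerSeries.constantCoeff Lminus : ℤ_[2]) : ℚ_[2]) = ((s : ℚ) : ℚ_[2]) := by
    rw [hLf0, hs_def]; push_cast; ring
  have hsQ0 : ((s : ℚ) : ℚ_[2]) ≠ 0 := by exact_mod_cast hs0
  have hsval : padicValRat 2 s = 0 := by
    have h := ht1
    rw [padicValRat.mul hϖ0 hs0, hϖ1, zero_add] at h
    exact h
  have hLnorm : ‖(PowerSeries.constantCoeff Lminus : ℤ_[2])‖ = 1 := by
    rw [PadicInt.norm_def, hLf0', Padic.norm_eq_zpow_neg_valuation hsQ0, Padic.valuation_ratCast,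
      hsval]
    simp
  -- `g := u · L⁻` is a unit of `Λ` with `ι g = ϖ · ι L⁻`
  refine ⟨PowerSeries.C u * Lminus, ?_, ?_⟩
  · have hgunit : IsUnit (PowerSeries.C u * Lminus) :=
      (PowerSeries.isUnit_iff_constantCoeff.mpr (by rwa [PowerSeries.constantCoeff_C])).mul
        (PowerSeries.isUnit_iff_constantCoeff.mpr (PadicInt.isUnit_iff.mpr hLnorm))
    rw [htop, eq_comm, Ideal.span_singleton_eq_top]
    exact hgunit
  · rw [map_mul]
    congr 1
    simp [iwasawaToPowerSeries, PowerSeries.map_C, hu_def]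

end MainConjecture

/-! ## §3. Crux K2 at a unit-zone CM curve, from crux K4c read for that curve -/

section Pointwise

/-- **K2 AT a unit-zone CM curve ⇐ K4c read for that curve + PUB.** Let `A/ℚ` be a CM curve
(globally minimal) good supersingular at `2` with `a₂ = 0`, `L(A,1) ≠ 0`, in the unit zone: for the
newform `f` of every modular parametrisation datum, `[0]⁺_f = L(f,1)/Ω⁺_f` and the period ratio `ϖ`
are `2`-adic units (so `t = L(A,1)/Ω_A` is: by BSD₂(A), IN PRINT for CM — Burungale–Flach 2024
`hBF` — this is `Ш(A)[2] = 0 ∧ ∏ c_ℓ` odd). Grant GZK (`hGZK`) and modularity (`hmod`) by name, and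
the two conjuncts of crux K4c `SignedControlAtTwo` READ FOR `A` (research binders at `2`): Kobayashi
Thm. 1.2 (`h12`: `X⁺(A/ℚ_∞)` f.g. AND `Λ`-torsion) and Kim Cor. 3.15 (`hKim`). Then BOTH conjuncts
of crux K2 hold AT `A`: every dual datum of `Sel⁺(A/ℚ_∞)` is torsion with `μ⁺ = 0`, and
`KobayashiMainConjecture A 2 1`. No elliptic units, no two-variable main conjecture: in the unit
zone the `μ = 0` SOURCE the route wants from K2 is delivered by control at `2` alone. (The unit-zone
hypothesis is stated per newform datum because the typed conjecture quantifies over all of them.)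
Nothing asserted beyond the binders. [cite: BurungaleFlach2024, Thm. 1.1]
[cite: Kobayashi2003, Thm. 1.2 and Conjecture (p. 2)] [cite: BDKim2013, Cor. 3.15 (p odd in print)] -/
theorem signedMainConjectureCMTwo_pointwise_of_unitZone [Fact (Nat.Prime 2)]
    (hBF : bsdTriple_of_hasCM_of_L_one_ne_zero)
    (hmod : nonempty_modularParametrizationData)
    (hGZK : rank_eq_analyticRank_of_analyticRank_le_one)
    (hcm : A.HasCM) (hss : GoodSS A 2) (ha : A.frobeniusTrace 2 = 0) (hL : A.entireLFunction 1 ≠ 0)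
    (h12 : ∀ (κ : ZpExtension ℚ 2) (γ : Field.absoluteGaloisGroup ℚ),
      κ.IsCyclotomic → κ.IsTopGenerator γ →
      ∀ D : SignedSelmerDualData A κ γ 1,
        Module.Finite (IwasawaAlgebra 2) D.X ∧ Module.IsTorsion (IwasawaAlgebra 2) D.X)
    (hKim : ∀ (κ : ZpExtension ℚ 2) (γ : Field.absoluteGaloisGroup ℚ),
      κ.IsCyclotomic → κ.IsTopGenerator γ →
      ∀ (D : SignedSelmerDualData A κ γ 1) [Module.Finite (IwasawaAlgebra 2) D.X],
        Module.IsTorsion (IwasawaAlgebra 2) D.X →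
      ∀ g : IwasawaAlgebra 2, D.charIdeal = Ideal.span {g} → Finite (A.selmerGroupPInfty 2) →
        ∃ u : ℤ_[2]ˣ, ((PowerSeries.constantCoeff g : ℤ_[2]) : ℚ_[2]) =
          ((u : ℤ_[2]) : ℚ_[2]) * ((2 : ℕ) : ℚ_[2]) ^ (padicValNat 2 A.tamagawaProduct) *
            (Nat.card (A.selmerGroupPInfty 2) : ℚ_[2]))
    (hzone : ∀ [NeZero (A.conductorNorm ℤ)] (f : CuspForm (Gamma0 (A.conductorNorm ℤ)) 2),
      IsNewformOf A f → ∀ (ϖ : ℚ), (ϖ : ℝ) * A.realPeriodRat = plusPeriod f →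
        padicValRat 2 ϖ = 0 ∧ padicValRat 2 (ratPlusSymbol f 0) = 0) :
    (∀ (κ : ZpExtension ℚ 2) (γ : Field.absoluteGaloisGroup ℚ), κ.IsCyclotomic → κ.IsTopGenerator γ →
      ∀ D : SignedSelmerDualData A κ γ 1, Module.IsTorsion (IwasawaAlgebra 2) D.X ∧ D.mu = 0) ∧
    KobayashiMainConjecture A 2 1 := by
  have hBSD : BSDp A 2 :=
    forall_bsdp_of_bsdTriple A A.tamagawaProduct_pos_holds (hBF A hcm hL) 2 Nat.prime_two
  have hΩpos : 0 < A.realPeriodRat := A.realPeriodRat_pos_holds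
  -- for a newform `f` of `A` with period ratio `ϖ`: `t = ϖ·[0]⁺_f = L(A,1)/Ω_A` has `ord₂ t = 0`
  have key : ∀ [NeZero (A.conductorNorm ℤ)] (f : CuspForm (Gamma0 (A.conductorNorm ℤ)) 2),
      IsNewformOf A f → ∀ (ϖ : ℚ), (ϖ : ℝ) * A.realPeriodRat = plusPeriod f →
        A.entireLFunction 1 / (A.realPeriodRat : ℂ) = ((ϖ * ratPlusSymbol f 0 : ℚ) : ℂ) ∧
          padicValRat 2 (ϖ * ratPlusSymbol f 0) = 0 := by
    intro _ f hf ϖ hϖ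
    obtain ⟨hϖ1, hs1⟩ := hzone f hf ϖ hϖ
    have hLval : A.entireLFunction 1 = (((ratPlusSymbol f 0 : ℝ) * plusPeriod f : ℝ) : ℂ) :=
      hf.entireLFunction_one_eq
    have hs0 : ratPlusSymbol f 0 ≠ 0 := by
      intro h0
      apply hL
      rw [hLval, h0]
      simp
    have hϖ0 : ϖ ≠ 0 := by
      rintro rfl
      apply hL
      have h : plusPeriod f = 0 := by
        have h := hϖ
        simp only [Rat.cast_zero, zero_mul] at h
        exact h.symm
      rw [hLval, h]
      simp
    refine ⟨?_, by rw [padicValRat.mul hϖ0 hs0, hϖ1, hs1, add_zero]⟩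
    rw [hLval, ← hϖ, div_eq_iff (Complex.ofReal_ne_zero.mpr hΩpos.ne')]
    push_cast
    ring
  refine ⟨fun κ γ hκ hγ D => ?_, ?_⟩
  · obtain ⟨hfin, hTors⟩ := h12 κ γ hκ hγ D
    haveI := hfin
    refine ⟨hTors, ?_⟩
    -- a newform datum (modularity) to name `t`
    haveI : NeZero (A.conductorNorm ℤ) := ⟨(A.conductorNorm_pos_holds).ne'⟩
    obtain ⟨Dm⟩ := hmod A
    obtain ⟨ϖ, -, hϖeq, -⟩ := Dm.exists_rat_mul_realPeriodRat_eq_plusPeriod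
    obtain ⟨ht, ht1⟩ := key Dm.f Dm.isNewformOf ϖ hϖeq
    exact (charIdeal_eq_top_and_mu_eq_zero_of_unitZone_two A hGZK hss hL hBSD hKim hκ hγ D hTors
      ht ht1).2
  · intro κ γ hκ hγ _ _ f hf ϖ hϖ Lplus Lminus hPP D
    obtain ⟨hfin, hTors⟩ := h12 κ γ hκ hγ D
    haveI := hfin
    obtain ⟨hϖ1, -⟩ := hzone f hf ϖ hϖ
    obtain ⟨-, ht1⟩ := key f hf ϖ hϖ
    exact ⟨hTors, kobayashiMainConjecture_two_one_conclusion_of_unitZone A hGZK hss ha hL hBSD hKim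
      hκ hγ D hTors hf hϖ hϖ1 ht1 hPP⟩

end Pointwise

end Summit.BirchSwinnertonDyer.BirchSwinnertonDyer.Theorems

end
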